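/-
Copyright: public-audit package `pub-balaban` (b2b-balaban), seat pv09-g4. Released under Apache 2.0 like Mathlib.
-/
import Literature.MathematicalPhysics.QuantumFieldTheory.Balaban1983to89.B6Lemma24Kappa

/-!
# B6, p. 245: no repair of the layer sentence has an L-independent constant (upper bound κ ≤ 12/(L + 1))

Source under audit: T. Bałaban, *Propagators and renormalization transformations for lattice gauge theories.
II*, Commun. Math. Phys. **96** (1984) 223–250 [B6], proof of Lemma 2.4, p. 245.  Companion of
`B6LayerPoincare` (κ₀), `B6LayerPoincarePair` (κ₁) and `B6Lemma24Kappa` (`LayerIneq d L κ`, the layer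
inequality with a free constant κ).

## The printed sentence (verbatim, p. 245, between (2.126) and (2.127))

*"The terms in parentheses on the right-hand side can be written as L^{−2}⟨B, (Δ_{Δ′}^{L^{−1},N} +
Q′*_{Δ′}Q′_{Δ′})B⟩, where the operators are defined on a d − 1-dimensional lattice.  This quadratic form is
bounded from below by L^{−d−1} Σ_{x∈Δ′} |B_μ(x)|², hence"* [(2.127) follows].  (Same quotation as in
`B6LayerPoincare`; the parenthesis of (2.126) is ⅓ (L^{−d} Σ_{b⊂Δ′} |(∂B_μ)(b)|² + L^{−2} |Σ_{x∈Δ′} L^{−(d−1)} B_μ(x)|²).)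

## Status and what this file proves

The sentence claims the layer inequality `LayerIneq d L κ` with κ = 1; it is FALSE for L ≥ 10 (census G-B6-09,
kernel witness `B6.claim_p245_fails_L10`, one numerical instance checked by `decide`).  The package repaired it
with constants of order 1/L (`kappa0`, `kappa1 d L = 2/(2 + (d−1)(L−1))`; census constant κ_L = min{1, 4L sin²(π/2L)}
= `B6.kappaL`, certified in prose only).  THIS FILE proves in the kernel that order 1/L is forced: for all d ≥ 2,
L ≥ 2 and every real κ,

  `LayerIneq d L κ → κ ≤ 12 / (L + 1)`                                  (`layerIneq_le`),

hence the layer inequality fails for every κ > 12/(L + 1) (`not_layerIneq`), in particular with the printed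
factor κ = 1 for every L ≥ 12 and every d ≥ 2 (`not_layerIneq_one`), and κ₁(2, L) = 2/(L + 1) is within the
factor 6 of the best possible constant in d = 2 (`kappa1_two`, `le_six_mul_kappa1_two`, `optimal_window_two`).

## Proof (elementary)

Test the inequality at the corner y = 0, face direction μ = e₀, with g(x) = x₁ − (L − 1)/2 (linear in the
tangential direction ν = e₁).  The layer Δ′ is the product {L − 1} × [0, L)^{d−1} (`lastLayer_zero_eq`), so sums
over Δ′ of functions of x₁ factor as L^{d−2} times a one-dimensional sum (`sum_lastLayer_coord`;
`sum_Ico_centred`, `sum_Ico_centred_sq`, `sum_Ico_indicator`):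
Σ g = 0, Σ g² = L^{d−2} · L(L² − 1)/12, and the gradient form counts the e₁-bonds inside Δ′,
Σ_{b⊂Δ′}(g(b₊) − g(b₋))² = L^{d−2}(L − 1) (`gradSq_test`).  Inserting, κ L^{−d−1} L^{d−2} L(L² − 1)/12 ≤
L^{−d} L^{d−2}(L − 1), i.e. κ (L + 1) ≤ 12.

## HONEST SCOPE

Nothing printed is asserted or used.  The bound 12/(L + 1) is not sharp (the sharp constant is L·λ₁(P_L) =
4L sin²(π/2L), census G-B6-09R/G-B6-10, not formalised); it certifies only the ORDER 1/L of every admissible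
constant, i.e. that the printed derivation of (2.127)/(2.128) through this sentence cannot yield an
L-independent factor.  It says nothing about the constant of Lemma 2.4 (2.128) itself, whose printed value
1/(12d²) is numerically supported and unproved (G-B6-09R).
-/

namespace Literature.MathematicalPhysics.QuantumFieldTheory.Balaban1983to89.B6LayerUpperBound

open Finset
open B6Elimination (block mem_block)
open B6BondElimination (unitVec unitVec_apply add_unitVec_apply)
open B6FaceInterpolation (lastLayer bondsIn mem_lastLayer mem_bondsIn)
open B6LayerPoincare (gradSq)
open B6LayerPoincarePair (kappa1)
open B6Lemma24Kappa (LayerIneq layerIneq_kappa1)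

noncomputable section

variable {d : ℕ} {L : ℕ}

/-! ## §1  One-dimensional sums -/

/-- Σ_{a ∈ [0, L) ⊂ ℤ} F(a) = Σ_{n < L} F(n). [folklore] -/
theorem sum_Ico_int_eq_sum_range (L : ℕ) (F : ℤ → ℝ) :
    ∑ a ∈ Ico (0 : ℤ) (L : ℤ), F a = ∑ n ∈ range L, F (n : ℤ) := by
  have h : Ico (0 : ℤ) (L : ℤ) = (range L).image (fun n : ℕ => (n : ℤ)) := by
    ext a
    simp only [mem_Ico, mem_image, mem_range]
    constructor
    · rintro ⟨h0, h1⟩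
      exact ⟨a.toNat, by omega, by omega⟩
    · rintro ⟨n, hn, rfl⟩; omega
  rw [h, sum_image fun n _ m _ hnm => by exact_mod_cast hnm]

/-- The centred linear profile on [0, L) ⊂ ℤ has mean zero: Σ_{0≤a<L} (a − (L−1)/2) = 0. [folklore] -/
theorem sum_Ico_centred (L : ℕ) : ∑ a ∈ Ico (0 : ℤ) (L : ℤ), ((a : ℝ) - ((L : ℝ) - 1) / 2) = 0 := by
  have h1 : ∀ M : ℕ, ∑ n ∈ range M, (n : ℝ) = (M : ℝ) * ((M : ℝ) - 1) / 2 := by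
    intro M
    induction M with
    | zero => simp
    | succ n ih => rw [sum_range_succ, ih]; push_cast; ring
  rw [sum_Ico_int_eq_sum_range]
  simp only [Int.cast_natCast]
  rw [sum_sub_distrib, h1 L, sum_const, card_range, nsmul_eq_mul]
  ring

/-- Its second moment: Σ_{0≤a<L} (a − (L−1)/2)² = L(L² − 1)/12 (cf. `Beta.ElimJacobianAlgebra.sum_range_sq_sub_center`,
the same computation over `range L`). [folklore] -/
theorem sum_Ico_centred_sq (L : ℕ) :
    ∑ a ∈ Ico (0 : ℤ) (L : ℤ), ((a : ℝ) - ((L : ℝ) - 1) / 2) ^ 2 = (L : ℝ) * ((L : ℝ) ^ 2 - 1) / 12 := by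
  have h1 : ∀ M : ℕ, ∑ n ∈ range M, (n : ℝ) = (M : ℝ) * ((M : ℝ) - 1) / 2 := by
    intro M
    induction M with
    | zero => simp
    | succ n ih => rw [sum_range_succ, ih]; push_cast; ring
  have h2 : ∀ M : ℕ, ∑ n ∈ range M, (n : ℝ) ^ 2 = (M : ℝ) * ((M : ℝ) - 1) * (2 * (M : ℝ) - 1) / 6 := by
    intro M
    induction M with
    | zero => simp
    | succ n ih => rw [sum_range_succ, ih]; push_cast; ring
  have h : ∀ n : ℕ, ((n : ℝ) - ((L : ℝ) - 1) / 2) ^ 2 =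
      (n : ℝ) ^ 2 - ((L : ℝ) - 1) * (n : ℝ) + (((L : ℝ) - 1) / 2) ^ 2 := fun n => by ring
  rw [sum_Ico_int_eq_sum_range]
  simp only [Int.cast_natCast]
  simp_rw [h]
  rw [sum_add_distrib, sum_sub_distrib, h2 L, ← mul_sum, h1 L, sum_const, card_range, nsmul_eq_mul]
  ring

/-- The indicator count: Σ_{0≤a<L} [a + 1 < L] = L − 1 (L ≥ 1). [folklore] -/
theorem sum_Ico_indicator (hL : 1 ≤ L) :
    ∑ a ∈ Ico (0 : ℤ) (L : ℤ), (if a + 1 < (L : ℤ) then (1 : ℝ) else 0) = (L : ℝ) - 1 := by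
  rw [sum_Ico_int_eq_sum_range]
  obtain ⟨M, rfl⟩ : ∃ M, L = M + 1 := ⟨L - 1, by omega⟩
  rw [sum_range_succ, if_neg (by push_cast; omega),
    sum_congr rfl fun n hn => if_pos (by have := mem_range.1 hn; push_cast; omega), sum_const, card_range,
    nsmul_eq_mul]
  push_cast; ring

/-! ## §2  The product structure of Δ′ at the corner 0 and one-coordinate sums -/

/-- The interval family whose product is Δ′(0, μ): {L − 1} in the slot μ, [0, L) elsewhere. [folklore] -/
def slots (L : ℕ) (μ : Fin d) (i : Fin d) : Finset ℤ := if i = μ then {(L : ℤ) - 1} else Ico 0 (L : ℤ)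

/-- Δ′(0, μ) = Π_i slots_i (L ≥ 1). [folklore] -/
theorem lastLayer_zero_eq (hL : 1 ≤ L) (μ : Fin d) :
    lastLayer L (0 : Fin d → ℤ) μ = Fintype.piFinset (slots L μ) := by
  classical
  ext x
  rw [mem_lastLayer, mem_block, Fintype.mem_piFinset]
  simp only [Pi.zero_apply, zero_add]
  constructor
  · rintro ⟨hb, hμ⟩ i
    unfold slots
    split_ifs with hi
    · rw [hi, mem_singleton]; omega
    · exact mem_Ico.2 (hb i)
  · intro hx
    have hxμ := hx μ
    unfold slots at hxμ
    rw [if_pos rfl, mem_singleton] at hxμ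
    refine ⟨fun i => ?_, by omega⟩
    have hxi := hx i
    unfold slots at hxi
    split_ifs at hxi with hi
    · rw [mem_singleton] at hxi; subst hi; omega
    · exact mem_Ico.1 hxi

/-- Sums over a product set of a function of one coordinate factor. [folklore] -/
theorem sum_piFinset_coord (t : Fin d → Finset ℤ) (ν : Fin d) (F : ℤ → ℝ) :
    ∑ x ∈ Fintype.piFinset t, F (x ν) = (∏ i ∈ univ.erase ν, (#(t i) : ℝ)) * ∑ a ∈ t ν, F a := by
  classical
  have h := Finset.prod_univ_sum t (fun i (a : ℤ) => if i = ν then F a else (1 : ℝ))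
  have h2 : ∀ x : Fin d → ℤ, (∏ i, if i = ν then F (x i) else (1 : ℝ)) = F (x ν) := fun x => by
    rw [prod_ite_eq']; simp
  simp_rw [h2] at h
  rw [← h, ← mul_prod_erase univ _ (mem_univ ν)]
  simp only [↓reduceIte]
  rw [mul_comm]
  congr 1
  refine prod_congr rfl fun i hi => ?_
  rw [sum_congr rfl fun a _ => if_neg (ne_of_mem_erase hi), sum_const, nsmul_eq_mul, mul_one]

/-- For ν ≠ μ: Π_{i ≠ ν} #slots_i = L^{d−2}. [folklore] -/
theorem prod_card_slots {μ ν : Fin d} (hμν : ν ≠ μ) :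
    (∏ i ∈ univ.erase ν, (#(slots L μ i) : ℝ)) = (L : ℝ) ^ (d - 2) := by
  classical
  have hμ : μ ∈ univ.erase ν := mem_erase.2 ⟨hμν.symm, mem_univ _⟩
  rw [← mul_prod_erase _ _ hμ]
  have h1 : (#(slots L μ μ) : ℝ) = 1 := by simp [slots]
  rw [h1, one_mul, prod_congr rfl fun i hi => show (#(slots L μ i) : ℝ) = L by
    rw [slots, if_neg (ne_of_mem_erase hi), Int.card_Ico]; simp]
  rw [prod_const, card_erase_of_mem hμ, card_erase_of_mem (mem_univ ν), card_univ, Fintype.card_fin, Nat.sub_sub]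

/-- One-coordinate sums over Δ′(0, μ) in a tangential direction ν ≠ μ:
Σ_{x∈Δ′} F(x_ν) = L^{d−2} Σ_{0≤a<L} F(a). [folklore] -/
theorem sum_lastLayer_coord (hL : 1 ≤ L) {μ ν : Fin d} (hμν : ν ≠ μ) (F : ℤ → ℝ) :
    ∑ x ∈ lastLayer L (0 : Fin d → ℤ) μ, F (x ν) = (L : ℝ) ^ (d - 2) * ∑ a ∈ Ico (0 : ℤ) (L : ℤ), F a := by
  rw [lastLayer_zero_eq hL, sum_piFinset_coord, prod_card_slots hμν]
  simp [slots, if_neg hμν]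

/-! ## §3  The test function and its three sums -/

/-- The test function g(x) = x_ν − (L − 1)/2. [folklore] -/
def test (L : ℕ) (ν : Fin d) (x : Fin d → ℤ) : ℝ := (x ν : ℝ) - ((L : ℝ) - 1) / 2

/-- Σ_{Δ′} g = 0. [folklore] -/
theorem sum_test (hL : 1 ≤ L) {μ ν : Fin d} (hμν : ν ≠ μ) :
    ∑ x ∈ lastLayer L (0 : Fin d → ℤ) μ, test L ν x = 0 := by
  have h := sum_lastLayer_coord hL hμν (fun a => (a : ℝ) - ((L : ℝ) - 1) / 2)
  rw [sum_Ico_centred, mul_zero] at h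
  exact h

/-- Σ_{Δ′} g² = L^{d−2} · L(L² − 1)/12. [folklore] -/
theorem sum_test_sq (hL : 1 ≤ L) {μ ν : Fin d} (hμν : ν ≠ μ) :
    ∑ x ∈ lastLayer L (0 : Fin d → ℤ) μ, test L ν x ^ 2 =
      (L : ℝ) ^ (d - 2) * ((L : ℝ) * ((L : ℝ) ^ 2 - 1) / 12) := by
  have h := sum_lastLayer_coord hL hμν (fun a => ((a : ℝ) - ((L : ℝ) - 1) / 2) ^ 2)
  rw [sum_Ico_centred_sq] at h
  exact h

/-- Inside Δ′(0, μ), the shifted site x + e_ν (ν ≠ μ) stays in Δ′ iff x_ν + 1 < L. [folklore] -/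
theorem add_unitVec_mem_lastLayer_iff {μ ν : Fin d} (hμν : ν ≠ μ) {x : Fin d → ℤ}
    (hx : x ∈ lastLayer L (0 : Fin d → ℤ) μ) :
    x + unitVec ν ∈ lastLayer L (0 : Fin d → ℤ) μ ↔ x ν + 1 < (L : ℤ) := by
  rw [mem_lastLayer, mem_block] at hx ⊢
  simp only [Pi.zero_apply, zero_add, add_unitVec_apply] at hx ⊢
  obtain ⟨hb, hμ⟩ := hx
  constructor
  · rintro ⟨hb', -⟩
    have := (hb' ν).2
    rw [if_pos rfl] at this
    exact this
  · intro hlt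
    refine ⟨fun i => ?_, by rw [if_neg hμν.symm]; simpa using hμ⟩
    by_cases hi : i = ν
    · subst hi; rw [if_pos rfl]; have := hb i; omega
    · rw [if_neg hi, add_zero]; exact hb i

/-- The gradient form of the test function counts the e_ν-bonds inside Δ′:
Σ_{b⊂Δ′}(g(b₊) − g(b₋))² = L^{d−2}(L − 1). [folklore] -/
theorem gradSq_test (hL : 1 ≤ L) {μ ν : Fin d} (hμν : ν ≠ μ) :
    gradSq (test L ν) (lastLayer L (0 : Fin d → ℤ) μ) = (L : ℝ) ^ (d - 2) * ((L : ℝ) - 1) := by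
  classical
  set Δ := lastLayer L (0 : Fin d → ℤ) μ with hΔ
  -- the summand is the indicator of the direction ν
  have h1 : gradSq (test L ν) Δ = ∑ b ∈ bondsIn Δ, (if b.2 = ν then (1 : ℝ) else 0) := by
    unfold gradSq
    refine sum_congr rfl fun b _ => ?_
    simp only [test, add_unitVec_apply]
    by_cases hb : b.2 = ν
    · rw [if_pos hb, if_pos hb.symm]; push_cast; ring
    · rw [if_neg hb, if_neg (Ne.symm hb)]; push_cast; ring
  -- count the ν-bonds by their starting points
  have h2 : ∑ b ∈ bondsIn Δ, (if b.2 = ν then (1 : ℝ) else 0) =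
      (#((bondsIn Δ).filter fun b => b.2 = ν) : ℝ) := by
    rw [sum_boole]
  have h3 : #((bondsIn Δ).filter fun b => b.2 = ν) = #(Δ.filter fun x => x + unitVec ν ∈ Δ) := by
    refine card_nbij' (fun b => b.1) (fun x => (x, ν)) ?_ ?_ ?_ ?_
    · intro b hb
      rw [mem_coe, mem_filter, mem_bondsIn] at hb
      rw [mem_coe, mem_filter]
      obtain ⟨⟨h1b, h2b⟩, h3b⟩ := hb
      rw [h3b] at h2b
      exact ⟨h1b, h2b⟩
    · intro x hx
      rw [mem_coe, mem_filter] at hx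
      rw [mem_coe, mem_filter, mem_bondsIn]
      exact ⟨⟨hx.1, hx.2⟩, rfl⟩
    · intro b hb
      rw [mem_coe, mem_filter] at hb
      exact Prod.ext rfl hb.2.symm
    · intro x _; rfl
  have h4 : (#(Δ.filter fun x => x + unitVec ν ∈ Δ) : ℝ) =
      ∑ x ∈ Δ, (if x ν + 1 < (L : ℤ) then (1 : ℝ) else 0) := by
    rw [card_filter]
    push_cast
    refine sum_congr rfl fun x hx => ?_
    by_cases h : x ν + 1 < (L : ℤ)
    · rw [if_pos h, if_pos ((add_unitVec_mem_lastLayer_iff hμν hx).2 h)]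
    · rw [if_neg h, if_neg (fun h' => h ((add_unitVec_mem_lastLayer_iff hμν hx).1 h'))]
  rw [h1, h2, h3, h4, hΔ, sum_lastLayer_coord hL hμν (fun a => if a + 1 < (L : ℤ) then (1 : ℝ) else 0),
    sum_Ico_indicator hL]

/-! ## §4  The upper bound -/

/-- **No L-independent layer constant.**  If the layer inequality holds with constant κ (d ≥ 2, L ≥ 2), then
κ ≤ 12/(L + 1).  In particular every admissible constant is of order 1/L, like the package's κ₀, κ₁ and the
census's κ_L. [folklore] -/
theorem layerIneq_le (hd : 2 ≤ d) (hL : 2 ≤ L) {κ : ℝ} (h : LayerIneq d L κ) : κ ≤ 12 / ((L : ℝ) + 1) := by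
  obtain ⟨k, rfl⟩ : ∃ k, d = k + 2 := ⟨d - 2, by omega⟩
  set μ : Fin (k + 2) := ⟨0, by omega⟩ with hμ
  set ν : Fin (k + 2) := ⟨1, by omega⟩ with hν
  have hμν : ν ≠ μ := by
    intro e; have := congrArg Fin.val e; simp [hμ, hν] at this
  have hL1 : 1 ≤ L := by omega
  have hLr : (2 : ℝ) ≤ L := by exact_mod_cast hL
  have hL0 : (0 : ℝ) < L := by linarith
  have key := h 0 μ (test L ν)
  rw [sum_test hL1 hμν, sum_test_sq hL1 hμν, gradSq_test hL1 hμν] at key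
  simp only [Nat.add_sub_cancel, mul_zero, zero_pow two_ne_zero] at key
  -- clear the powers of L
  have e1 : ((L : ℝ)⁻¹) ^ (k + 2 + 1) * ((L : ℝ) ^ k * ((L : ℝ) * ((L : ℝ) ^ 2 - 1) / 12)) =
      ((L : ℝ) ^ 2 - 1) / 12 * ((L : ℝ)⁻¹) ^ 2 := by
    rw [inv_pow, inv_pow]; field_simp; ring
  have e2 : ((L : ℝ)⁻¹) ^ (k + 2) * ((L : ℝ) ^ k * ((L : ℝ) - 1)) = ((L : ℝ) - 1) * ((L : ℝ)⁻¹) ^ 2 := by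
    rw [inv_pow, inv_pow]; field_simp; ring
  have key' : κ * (((L : ℝ) ^ 2 - 1) / 12 * ((L : ℝ)⁻¹) ^ 2) ≤ ((L : ℝ) - 1) * ((L : ℝ)⁻¹) ^ 2 := by
    have := key; rw [mul_assoc, e1, e2] at this; linarith
  have hinv : (0 : ℝ) < ((L : ℝ)⁻¹) ^ 2 := by positivity
  have key'' : κ * (((L : ℝ) ^ 2 - 1) / 12) ≤ (L : ℝ) - 1 := by
    have := div_le_div_of_nonneg_right key' hinv.le
    rwa [← mul_assoc, mul_div_assoc, mul_div_assoc, div_self hinv.ne', mul_one, mul_one] at this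
  rw [le_div_iff₀ (by linarith)]
  nlinarith [key'', hLr]

/-- Contrapositive: the layer inequality fails for every κ > 12/(L + 1). [folklore] -/
theorem not_layerIneq (hd : 2 ≤ d) (hL : 2 ≤ L) {κ : ℝ} (hκ : 12 / ((L : ℝ) + 1) < κ) : ¬ LayerIneq d L κ :=
  fun h => absurd (layerIneq_le hd hL h) (not_le.2 hκ)

/-- The printed factor 1 is impossible for every L ≥ 12 (all d ≥ 2).  (For L = 10, 11 the factor 1 also fails,
but only by the sharper census value κ_L < 1; in the kernel: `B6.claim_p245_fails_L10` for L = 10, L = 11 not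
formalised.) [folklore] -/
theorem not_layerIneq_one (hd : 2 ≤ d) (hL : 12 ≤ L) : ¬ LayerIneq d L 1 := by
  refine not_layerIneq hd (by omega) ?_
  have : (12 : ℝ) ≤ L := by exact_mod_cast hL
  rw [div_lt_one (by linarith)]
  linarith

/-- In d = 2 the package constant is κ₁(2, L) = 2/(L + 1). [folklore] -/
theorem kappa1_two (L : ℕ) : kappa1 2 L = 2 / ((L : ℝ) + 1) := by
  rw [kappa1]; push_cast; ring_nf

/-- Hence in d = 2 every admissible constant is at most 6 κ₁(2, L): κ₁ is within the factor 6 of optimal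
(L ≥ 2). [folklore] -/
theorem le_six_mul_kappa1_two (hL : 2 ≤ L) {κ : ℝ} (h : LayerIneq 2 L κ) : κ ≤ 6 * kappa1 2 L := by
  rw [kappa1_two]
  rw [show (6 : ℝ) * (2 / ((L : ℝ) + 1)) = 12 / ((L : ℝ) + 1) by ring]
  exact layerIneq_le (le_refl 2) hL h

/-- And κ₁(2, L) itself is admissible (`B6Lemma24Kappa.layerIneq_kappa1`), so the optimal layer constant in
d = 2 lies in [2/(L + 1), 12/(L + 1)]. [folklore] -/
theorem optimal_window_two (hL : 2 ≤ L) :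
    LayerIneq 2 L (2 / ((L : ℝ) + 1)) ∧ ∀ κ : ℝ, LayerIneq 2 L κ → κ ≤ 12 / ((L : ℝ) + 1) := by
  refine ⟨?_, fun κ h => layerIneq_le (le_refl 2) hL h⟩
  rw [← kappa1_two]
  exact layerIneq_kappa1 (le_refl 2) (by omega)

end

end Literature.MathematicalPhysics.QuantumFieldTheory.Balaban1983to89.B6LayerUpperBound
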